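import Summits.CriticalPhenomena.Ising3DConformalLimit.Theses.UnitLightCone
import Summits.CriticalPhenomena.Ising3DConformalLimit.Theorems.HyperoctahedralRPTwoPointLimitIsotropicHolds

/-!
# `UnitSpeedTwoPoint` (crux stmt-CriticalPhenomena-17167, route `UnitLightCone`): the unit cone cannot be
# narrowed to the speed-`2` cone — TIGHTNESS of the support clause (negative-side support, refuter cdisprove seat)

The crux asks for Källén–Lehmann measures carried by the closed forward cone `{ω ≥ ‖k‖}` ("speed of light at
least `1`").  Here we record, sorry-free, that for EVERY admissible limit `(ρ, Δ, S)` of the crux the natural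
strengthening with the narrower cone `{ω ≥ 2‖k‖}` ("speed of light at least `2`") is FALSE in the axis frame:

* `cone_secondDifference` — model-blind: a measure carried by `{ω ≥ v‖k‖}` (`v ≥ 0`) gives
  `2∫e^{-ω|t|} ≤ ∫cos(k₀·(v h)) e^{-ω|t|} + (∫e^{-ω|t+h|} + ∫e^{-ω|t-h|})/2` for `0 ≤ h < t` — a transverse step
  of length `v h` costs at most a time step `h`;
* `rpow_neg_two_mul_le_endpoints` — convexity in the exponent: `B^{-2Δ} ≤ θ B⁻¹ + (1-θ) B⁻²`, `θ = 2(1-Δ)`,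
  for `1/2 ≤ Δ ≤ 1`;
* `unitSpeedTwoPoint_cone_not_narrowable_to_speed_two` — by the landed two-point isotropy
  (`HyperoctahedralRPTwoPoint.kernel_rotation_invariant`) and window/positivity/homogeneity
  (`twoPointKernelOfLimit_proof`) the kernel is `C₀‖x‖^{-2Δ}`, `C₀ > 0`, `1/2 ≤ Δ ≤ 1`; the speed-`2` inequality at
  `t = 1`, `h = 1/5` reads `2 ≤ (29/25)^{-Δ} + ((6/5)^{-2Δ} + (4/5)^{-2Δ})/2`, whose right side is convex in `Δ` and
  `< 2` at `Δ = 1/2` (`5/√29 + 25/24 ≈ 1.970`) and at `Δ = 1` (`16625/8352 ≈ 1.991`).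

Moral: the constant `1` in `μ{ω < ‖k‖} = 0` is within a factor `2` of optimal for the Ising limit kernel (the truth,
not typed here, is that every `v > 1` fails: the KL measure of `‖x‖^{-2Δ}` charges every neighbourhood of the cone
boundary, and sits ON it at `Δ = 1/2`).  This file does NOT refute the crux.
-/

noncomputable section

namespace Summit.CriticalPhenomena.Ising3DConformalLimit.Theorems.UnitSpeedTwoPoint.Negative

open MeasureTheory
open Literature.Probability.LatticeModels

/-- Pointwise speed-`v` light-cone inequality: if `|v k₀| ≤ ω` then
`2 e^{-ωt} ≤ cos(k₀ (v h)) e^{-ωt} + (e^{-ω(t+h)} + e^{-ω(t-h)})/2` (`cos θ ≥ 1 - θ²/2`, `cosh θ ≥ 1 + θ²/2`).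
[folklore] -/
theorem pointwise_cone {v k0 ω t : ℝ} (h : ℝ) (hk : |v * k0| ≤ ω) :
    2 * Real.exp (-(ω * t)) ≤ Real.cos (k0 * (v * h)) * Real.exp (-(ω * t)) +
      (Real.exp (-(ω * (t + h))) + Real.exp (-(ω * (t - h)))) / 2 := by
  have hE : 0 < Real.exp (-(ω * t)) := Real.exp_pos _
  have h1 : Real.exp (-(ω * (t + h))) = Real.exp (-(ω * t)) * Real.exp (-(ω * h)) := by
    rw [← Real.exp_add]; congr 1; ring
  have h2 : Real.exp (-(ω * (t - h))) = Real.exp (-(ω * t)) * Real.exp (ω * h) := by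
    rw [← Real.exp_add]; congr 1; ring
  have harg : k0 * (v * h) = (v * k0) * h := by ring
  have hcos : 1 - ((v * k0) * h) ^ 2 / 2 ≤ Real.cos (k0 * (v * h)) := by
    rw [harg]; exact Real.one_sub_sq_div_two_le_cos
  have hcosh : 1 + (ω * h) ^ 2 / 2 ≤ Real.cosh (ω * h) := by
    -- first two terms of the power series (cf. `DeBruijn1950.one_add_sq_div_two_le_cosh`)
    have hs := sum_le_hasSum (Finset.range 2)
      (fun n _ ↦ div_nonneg (by rw [pow_mul]; positivity) (Nat.cast_nonneg _)) (Real.hasSum_cosh (ω * h))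
    simpa [Finset.sum_range_succ, Nat.factorial] using hs
  have hcosh' : Real.cosh (ω * h) = (Real.exp (ω * h) + Real.exp (-(ω * h))) / 2 := Real.cosh_eq _
  have hsq : ((v * k0) * h) ^ 2 ≤ (ω * h) ^ 2 := by
    rw [mul_pow, mul_pow ω]
    apply mul_le_mul_of_nonneg_right _ (sq_nonneg _)
    exact sq_le_sq' (by linarith [neg_abs_le (v * k0)]) (le_trans (le_abs_self _) hk)
  have hbr : 0 ≤ Real.cos (k0 * (v * h)) + (Real.exp (-(ω * h)) + Real.exp (ω * h)) / 2 - 2 := by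
    have : (Real.exp (-(ω * h)) + Real.exp (ω * h)) / 2 = Real.cosh (ω * h) := by rw [hcosh']; ring
    rw [this]; linarith
  rw [h1, h2]
  nlinarith [mul_nonneg hE.le hbr]

/-- **Speed-`v` second-difference inequality.** If a positive measure `μ` on `ℝ² × ℝ` is carried by the cone
`{ω ≥ v‖k‖}` (`v ≥ 0`) and `e^{-ω(t-h)}` is integrable (`0 ≤ h < t`), then
`2 ∫ e^{-ω|t|} dμ ≤ ∫ cos(k₀ (v h)) e^{-ω|t|} dμ + (∫ e^{-ω|t+h|} dμ + ∫ e^{-ω|t-h|} dμ)/2`: for a kernel with such a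
representation a transverse step of length `v h` costs at most a time step of length `h`. [folklore] -/
theorem cone_secondDifference {v : ℝ} (hv : 0 ≤ v) (μ : Measure (EuclideanSpace ℝ (Fin 2) × ℝ))
    (hμ : μ {p : EuclideanSpace ℝ (Fin 2) × ℝ | p.2 < v * ‖p.1‖} = 0) {t h : ℝ} (hh : 0 ≤ h) (hht : h < t)
    (hint : Integrable (fun p : EuclideanSpace ℝ (Fin 2) × ℝ => Real.exp (-(p.2 * |t - h|))) μ) :
    2 * ∫ p, Real.exp (-(p.2 * |t|)) ∂μ ≤
      (∫ p, Real.cos (p.1 0 * (v * h)) * Real.exp (-(p.2 * |t|)) ∂μ) +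
        ((∫ p, Real.exp (-(p.2 * |t + h|)) ∂μ) + (∫ p, Real.exp (-(p.2 * |t - h|)) ∂μ)) / 2 := by
  have hae : ∀ᵐ p ∂μ, v * ‖p.1‖ ≤ p.2 := by
    have h0 := measure_eq_zero_iff_ae_notMem.1 hμ
    filter_upwards [h0] with p hp
    simpa [Set.mem_setOf_eq, not_lt] using hp
  have ht : 0 < t := lt_of_le_of_lt hh hht
  have habs_t : |t| = t := abs_of_pos ht
  have habs_p : |t + h| = t + h := abs_of_pos (by linarith)
  have habs_m : |t - h| = t - h := abs_of_pos (by linarith)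
  have hω : ∀ p : EuclideanSpace ℝ (Fin 2) × ℝ, v * ‖p.1‖ ≤ p.2 → 0 ≤ p.2 := fun p hp =>
    le_trans (mul_nonneg hv (norm_nonneg _)) hp
  have hdom : ∀ p : EuclideanSpace ℝ (Fin 2) × ℝ, v * ‖p.1‖ ≤ p.2 → ∀ s : ℝ, t - h ≤ s →
      Real.exp (-(p.2 * s)) ≤ Real.exp (-(p.2 * (t - h))) := by
    intro p hp s hs
    have := hω p hp
    exact Real.exp_le_exp.2 (by nlinarith)
  have hint_t : Integrable (fun p : EuclideanSpace ℝ (Fin 2) × ℝ => Real.exp (-(p.2 * |t|))) μ := by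
    refine hint.mono' (by fun_prop) ?_
    filter_upwards [hae] with p hp
    rw [Real.norm_eq_abs, abs_of_pos (Real.exp_pos _), habs_t, habs_m]
    exact hdom p hp t (by linarith)
  have hint_p : Integrable (fun p : EuclideanSpace ℝ (Fin 2) × ℝ => Real.exp (-(p.2 * |t + h|))) μ := by
    refine hint.mono' (by fun_prop) ?_
    filter_upwards [hae] with p hp
    rw [Real.norm_eq_abs, abs_of_pos (Real.exp_pos _), habs_p, habs_m]
    exact hdom p hp (t + h) (by linarith)
  have hint_c : Integrable (fun p : EuclideanSpace ℝ (Fin 2) × ℝ =>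
      Real.cos (p.1 0 * (v * h)) * Real.exp (-(p.2 * |t|))) μ := by
    refine hint_t.mono' (by fun_prop) ?_
    filter_upwards with p
    rw [norm_mul, Real.norm_eq_abs, Real.norm_eq_abs, abs_of_pos (Real.exp_pos _)]
    exact mul_le_of_le_one_left (Real.exp_pos _).le (Real.abs_cos_le_one _)
  have key : 0 ≤ ∫ p, ((Real.cos (p.1 0 * (v * h)) * Real.exp (-(p.2 * |t|)) +
      (Real.exp (-(p.2 * |t + h|)) + Real.exp (-(p.2 * |t - h|))) / 2) -
      2 * Real.exp (-(p.2 * |t|))) ∂μ := by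
    apply integral_nonneg_of_ae
    filter_upwards [hae] with p hp
    rw [Pi.zero_apply, sub_nonneg, habs_t, habs_p, habs_m]
    refine pointwise_cone h (le_trans ?_ hp)
    rw [abs_mul, abs_of_nonneg hv]
    exact mul_le_mul_of_nonneg_left (by simpa using PiLp.norm_apply_le p.1 0) hv
  have hI3 : Integrable (fun p : EuclideanSpace ℝ (Fin 2) × ℝ =>
      (Real.exp (-(p.2 * |t + h|)) + Real.exp (-(p.2 * |t - h|))) / 2) μ := (hint_p.add hint).div_const 2
  have hI1 : Integrable (fun p : EuclideanSpace ℝ (Fin 2) × ℝ =>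
      Real.cos (p.1 0 * (v * h)) * Real.exp (-(p.2 * |t|)) +
        (Real.exp (-(p.2 * |t + h|)) + Real.exp (-(p.2 * |t - h|))) / 2) μ := hint_c.add hI3
  have hI2 : Integrable (fun p : EuclideanSpace ℝ (Fin 2) × ℝ => 2 * Real.exp (-(p.2 * |t|))) μ :=
    hint_t.const_mul 2
  rw [integral_sub hI1 hI2, integral_add hint_c hI3, integral_div, integral_add hint_p hint,
    integral_const_mul] at key
  linarith

/-- Convexity in the exponent between `Δ = 1/2` and `Δ = 1`: for `B > 0` and `1/2 ≤ Δ ≤ 1`,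
`B^{-2Δ} ≤ θ B⁻¹ + (1 - θ) B⁻²` with `θ = 2(1 - Δ)`. [folklore] -/
theorem rpow_neg_two_mul_le_endpoints {B Δ : ℝ} (hB : 0 < B) (h1 : 1 / 2 ≤ Δ) (h2 : Δ ≤ 1) :
    B ^ (-(2 * Δ)) ≤ (2 * (1 - Δ)) * B⁻¹ + (1 - 2 * (1 - Δ)) * (B ^ 2)⁻¹ := by
  have hθ0 : 0 ≤ 2 * (1 - Δ) := by linarith
  have hθ1 : 0 ≤ 1 - 2 * (1 - Δ) := by linarith
  have key := convexOn_exp.2 (Set.mem_univ (Real.log B * (-1))) (Set.mem_univ (Real.log B * (-2))) hθ0 hθ1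
    (by ring)
  simp only [smul_eq_mul] at key
  have hexp : 2 * (1 - Δ) * (Real.log B * -1) + (1 - 2 * (1 - Δ)) * (Real.log B * -2) =
      Real.log B * (-(2 * Δ)) := by ring
  rw [hexp, ← Real.rpow_def_of_pos hB, ← Real.rpow_def_of_pos hB, ← Real.rpow_def_of_pos hB,
    Real.rpow_neg_one, Real.rpow_neg hB.le (2:ℝ), Real.rpow_two] at key
  exact key

/-- **TIGHTNESS of the support clause of `UnitSpeedTwoPoint`: the unit cone cannot be narrowed to the speed-`2`
cone.**  For every admissible limit `(ρ, Δ, S)` of the crux there is NO measure `μ` on `ℝ² × ℝ` with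
`μ{ω < 2‖k‖} = 0` realising the axis-frame clause: the kernel is `C₀‖x‖^{-2Δ}` (`kernel_rotation_invariant`,
`twoPointKernelOfLimit_proof`), and the speed-`2` second-difference inequality at `t = 1`, `h = 1/5`,
`2 ≤ (29/25)^{-Δ} + ((6/5)^{-2Δ} + (4/5)^{-2Δ})/2`, fails on the whole window `1/2 ≤ Δ ≤ 1` (convexity in `Δ` plus
the endpoint values `≈ 1.970`, `≈ 1.991`). [cite: GlimmJaffe1987, §6.2] -/
theorem unitSpeedTwoPoint_cone_not_narrowable_to_speed_two {ρ : ℝ → ℝ} {Δ : ℝ} {S : CorrFamily 3}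
    (hρ : ∀ δ ∈ Set.Ioc (0:ℝ) 1, 0 < ρ δ) (hlim : HasPointwiseScalingLimit (criticalCorr 3) ρ S)
    (hnd : IsNondegenerateTwoPoint S) (htr : IsTranslationInvariant S) (hsc : IsScaleCovariant Δ S) :
    ¬ ∃ μ : Measure (EuclideanSpace ℝ (Fin 2) × ℝ),
      μ {p : EuclideanSpace ℝ (Fin 2) × ℝ | p.2 < 2 * ‖p.1‖} = 0 ∧
        ∀ t a b : ℝ, t ≠ 0 → (fun x : EuclideanSpace ℝ (Fin 3) => S 2 ![0, x])
          (EuclideanSpace.single 0 a + EuclideanSpace.single 1 b + EuclideanSpace.single 2 t) =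
            ∫ p, Real.cos (p.1 0 * a + p.1 1 * b) * Real.exp (-(p.2 * |t|)) ∂μ := by
  rintro ⟨μ, hμ, hrep⟩
  -- tree input: window, positivity, homogeneity (item 1983) and O(3)-invariance (milestone 1984)
  obtain ⟨⟨hΔ1, hΔ2⟩, _, hpos, hhom, _⟩ :=
    Summit.CriticalPhenomena.Ising3DConformalLimit.HyperoctahedralRPTwoPoint.twoPointKernelOfLimit_proof
      ρ Δ S hρ hlim hnd htr hsc
  have hrot : ∀ (R : EuclideanSpace ℝ (Fin 3) ≃ₗᵢ[ℝ] EuclideanSpace ℝ (Fin 3)) (x : EuclideanSpace ℝ (Fin 3)),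
      S 2 ![0, R x] = S 2 ![0, x] := fun R x =>
    Summit.CriticalPhenomena.Ising3DConformalLimit.HyperoctahedralRPTwoPoint.kernel_rotation_invariant
      hρ hlim hnd htr hsc R x
  -- radial profile (Cartan–Dieudonné, as in `Lines/yukawa_subordination.lean`): K x = C₀ ‖x‖^{-2Δ} off 0
  set e : EuclideanSpace ℝ (Fin 3) := EuclideanSpace.single 2 (1 : ℝ) with he_def
  have he1 : ‖e‖ = 1 := by simp [he_def]
  set C₀ : ℝ := S 2 ![0, e] with hC₀
  have hK : ∀ x : EuclideanSpace ℝ (Fin 3), x ≠ 0 → S 2 ![0, x] = C₀ * ‖x‖ ^ (-(2 * Δ)) := by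
    intro x hx
    have hn : 0 < ‖x‖ := norm_pos_iff.mpr hx
    set u : EuclideanSpace ℝ (Fin 3) := ‖x‖⁻¹ • x with hu
    have hu1 : ‖u‖ = 1 := by rw [hu, norm_smul, norm_inv, norm_norm, inv_mul_cancel₀ hn.ne']
    have hxu : x = ‖x‖ • u := by rw [hu, smul_smul, mul_inv_cancel₀ hn.ne', one_smul]
    have hKu : S 2 ![0, u] = C₀ := by
      have h := Submodule.reflection_sub (show ‖e‖ = ‖u‖ by rw [hu1, he1])
      have h2 := hrot ((ℝ ∙ (e - u))ᗮ.reflection) e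
      rw [h] at h2
      exact h2
    calc S 2 ![0, x] = S 2 ![0, ‖x‖ • u] := by rw [← hxu]
      _ = ‖x‖ ^ (-(2 * Δ)) * S 2 ![0, u] := hhom _ hn u
      _ = C₀ * ‖x‖ ^ (-(2 * Δ)) := by rw [hKu, mul_comm]
  have hC₀pos : 0 < C₀ := by
    have he0 : e ≠ 0 := fun h => by
      rw [h, norm_zero] at he1
      exact zero_ne_one he1
    exact hpos e he0
  -- axis-frame values
  have hnorm : ∀ a b t : ℝ, ‖(EuclideanSpace.single 0 a + EuclideanSpace.single 1 b + EuclideanSpace.single 2 t :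
      EuclideanSpace ℝ (Fin 3))‖ = Real.sqrt (a ^ 2 + b ^ 2 + t ^ 2) := by
    intro a b t
    set p : EuclideanSpace ℝ (Fin 3) :=
      EuclideanSpace.single 0 a + EuclideanSpace.single 1 b + EuclideanSpace.single 2 t with hp
    have h0 : p 0 = a := by simp [hp]
    have h1 : p 1 = b := by simp [hp]
    have h2 : p 2 = t := by simp [hp]
    rw [EuclideanSpace.norm_eq, Fin.sum_univ_three]
    simp only [Real.norm_eq_abs, sq_abs, h0, h1, h2]
  have hne : ∀ a b t : ℝ, t ≠ 0 → (EuclideanSpace.single 0 a + EuclideanSpace.single 1 b +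
      EuclideanSpace.single 2 t : EuclideanSpace ℝ (Fin 3)) ≠ 0 := by
    intro a b t ht h
    have h2 : (EuclideanSpace.single 0 a + EuclideanSpace.single 1 b + EuclideanSpace.single 2 t :
        EuclideanSpace ℝ (Fin 3)) 2 = t := by simp
    rw [h] at h2
    exact ht (by simpa using h2.symm)
  have hval : ∀ a b t : ℝ, t ≠ 0 →
      C₀ * Real.sqrt (a ^ 2 + b ^ 2 + t ^ 2) ^ (-(2 * Δ)) =
        ∫ p, Real.cos (p.1 0 * a + p.1 1 * b) * Real.exp (-(p.2 * |t|)) ∂μ := by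
    intro a b t ht
    have h := hrep t a b ht
    simp only [] at h
    rw [hK _ (hne a b t ht), hnorm] at h
    exact h
  -- the four values entering the speed-2 second difference at t = 1, h = 1/5 (transverse step 2h = 2/5)
  have H1 := hval (2 * (1 / 5)) 0 1 one_ne_zero
  have H2 := hval 0 0 1 one_ne_zero
  have H3 := hval 0 0 (1 + 1 / 5) (by norm_num)
  have H4 := hval 0 0 (1 - 1 / 5) (by norm_num)
  simp only [mul_zero, add_zero, Real.cos_zero, one_mul] at H2 H3 H4
  simp only [mul_zero, add_zero] at H1
  have hs1 : Real.sqrt (0 ^ 2 + 0 ^ 2 + (1:ℝ) ^ 2) = 1 := by norm_num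
  have hs3 : Real.sqrt (0 ^ 2 + 0 ^ 2 + (1 + 1 / 5 : ℝ) ^ 2) = 6 / 5 := by
    rw [show (0:ℝ) ^ 2 + 0 ^ 2 + (1 + 1 / 5) ^ 2 = (6 / 5) ^ 2 by norm_num]
    exact Real.sqrt_sq (by norm_num)
  have hs4 : Real.sqrt (0 ^ 2 + 0 ^ 2 + (1 - 1 / 5 : ℝ) ^ 2) = 4 / 5 := by
    rw [show (0:ℝ) ^ 2 + 0 ^ 2 + (1 - 1 / 5) ^ 2 = (4 / 5) ^ 2 by norm_num]
    exact Real.sqrt_sq (by norm_num)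
  rw [hs1, Real.one_rpow, mul_one] at H2
  rw [hs3] at H3
  rw [hs4] at H4
  -- integrability of e^{-ω|1 - 1/5|}
  have hint : Integrable (fun p : EuclideanSpace ℝ (Fin 2) × ℝ => Real.exp (-(p.2 * |1 - 1 / 5|))) μ := by
    by_contra hni
    rw [integral_undef hni] at H4
    have : 0 < C₀ * ((4:ℝ) / 5) ^ (-(2 * Δ)) := mul_pos hC₀pos (Real.rpow_pos_of_pos (by norm_num) _)
    linarith
  have key := cone_secondDifference (by norm_num : (0:ℝ) ≤ 2) μ hμ (by norm_num : (0:ℝ) ≤ 1 / 5)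
    (by norm_num : (1:ℝ) / 5 < 1) hint
  rw [← H1, ← H2, ← H3, ← H4] at key
  -- key : 2 * C₀ ≤ C₀ * s ^ (-2Δ) + (C₀ * (6/5) ^ (-2Δ) + C₀ * (4/5) ^ (-2Δ)) / 2,  s = √(4/25 + 0 + 1)
  set s : ℝ := Real.sqrt ((2 * (1 / 5)) ^ 2 + 0 ^ 2 + 1 ^ 2) with hs_def
  have hs_pos : 0 < s := Real.sqrt_pos.2 (by norm_num)
  have hs_sq : s ^ 2 = 29 / 25 := by rw [hs_def, Real.sq_sqrt (by norm_num)]; norm_num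
  have hs_inv : s⁻¹ < 7925 / 8352 := by
    have hlt : (8352 : ℝ) / 7925 < s := by
      rw [hs_def, Real.lt_sqrt (by norm_num)]
      norm_num
    have := inv_strictAnti₀ (by norm_num : (0:ℝ) < 8352 / 7925) hlt
    simpa using this
  -- convexity in Δ: each power is below the chord between Δ = 1/2 and Δ = 1
  have c1 := rpow_neg_two_mul_le_endpoints hs_pos hΔ1 hΔ2
  have c3 := rpow_neg_two_mul_le_endpoints (by norm_num : (0:ℝ) < 6 / 5) hΔ1 hΔ2
  have c4 := rpow_neg_two_mul_le_endpoints (by norm_num : (0:ℝ) < 4 / 5) hΔ1 hΔ2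
  rw [hs_sq] at c1
  have hθ0 : 0 ≤ 2 * (1 - Δ) := by linarith
  have hθ1 : 0 ≤ 1 - 2 * (1 - Δ) := by linarith
  -- divide the second-difference inequality by C₀ and conclude
  have key' : 2 ≤ s ^ (-(2 * Δ)) + (((6:ℝ) / 5) ^ (-(2 * Δ)) + ((4:ℝ) / 5) ^ (-(2 * Δ))) / 2 := by
    have := key
    nlinarith [hC₀pos, this]
  nlinarith [mul_nonneg hθ0 (sub_nonneg.2 hs_inv.le), key', c1, c3, c4, hθ0, hθ1]

end Summit.CriticalPhenomena.Ising3DConformalLimit.Theorems.UnitSpeedTwoPoint.Negative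

end
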